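import Summits.RiemannHypothesis.RiemannHypothesis.Theorems.OddSectorOddOneSignedWindowsFormDomainDilation
import Summits.RiemannHypothesis.RiemannHypothesis.Theorems.OddSectorOddOneSignedWindowsSmallWindowFold
import HarnessLib

/-!
# A finite-energy odd window function at the bottom of the closed form IS an odd ground state
# (helper for crux `OddSector.OddOneSignedWindows`, item stmt-RiemannHypothesis-17778; RH-free)

`Theorems/OddSectorOddOneSignedWindowsFiniteEnergy.lean` proves that an odd-sector ground state `u`
(`IsWeilOddGroundState a u`) has finite energy and `P(u) + 𝓔_a(u) ≤ M_a + ε_od(a)` (Markov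
decomposition `Re Q = P + 𝓔_a − M_a‖·‖²` of `Literature/NumberTheory/LFunctions/WeilMarkovQuadratic.lean`).
This file proves the CONVERSE (`isWeilOddGroundState_of_energy_le`): an odd `v ∈ L²` living on
`[-a, a]` with `∫|v|² = 1`, finite archimedean energy and `P(v) + 𝓔_a(v) ≤ M_a + ε_od(a)` is an
odd-sector ground state — i.e. it is the `L²`-limit of `L²`-normalised odd window TEST functions
with `Re Q → ε_od(a)`. So sign arguments may fold / truncate / rearrange a ground state directly in
the form domain (where the energy inequalities live: folded-kernel inequality, Markov property) and
read the result as a ground state of the crux again; the small-window theorem and the fold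
criterion (reflected-pair cost) are instances.

## Proof

Compress `v` by the unitary dilation `v_η = weilDilate η v` (`η → 0⁺`; support `[-a/(1+η), a/(1+η)]`
strictly inside the window): `‖v_η − v‖₂ → 0`, `P(v_η) → P(v)`
(`tendsto_weilPoleForm_of_window`) and `𝓔_a(v_η) → 𝓔_a(v)` (`tendsto_weilDirichletEnergy_weilDilate`:
`D_t(v_η) = D_{(1+η)t}(v)`, continuity of `t ↦ D_t(v)` for the prime lengths, and for the
archimedean part the substitution `s = (1+η)t` plus dominated convergence with dominator
`ρ(s/2) D_s(v)`, integrable because `ρ(s/2) ≤ 2e^{s/4}ρ(s)` and `D_s(v) = 2‖v‖²` beyond `2a`). Then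
mollify `v_η` by even bumps of radius `< a − a/(1+η)` (`exists_odd_mollified_seq`): odd tests on the
window `a` with dominated increments, hence `𝓔_a ≤ 𝓔_a(v_η)`, converging to `v_η` with their pole
forms. A diagonal sequence `gₙ → v` of odd window tests has `limsup (P + 𝓔_a)(gₙ) ≤ M_a + ε_od(a)`;
renormalised, `ε_od(a) ≤ Re Q(gₙ/‖gₙ‖) = (P + 𝓔_a)(gₙ)/‖gₙ‖² − M_a → ε_od(a)`, and
`IsWeilOddGroundState.of_tendsto` concludes.

References: M. Fukushima, Y. Oshima, M. Takeda (2011), §1.1; E. Bombieri, Rend. Mat. Acc. Lincei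
(9) 11 (2000), §4 (Thm 3, Thm 5).
-/

noncomputable section

set_option linter.dupNamespace false

open MeasureTheory Set Filter
open scoped Topology ENNReal ArithmeticFunction.vonMangoldt

namespace Summit.RiemannHypothesis.RiemannHypothesis.Theorems.OddSector

open Literature.NumberTheory.LFunctions Literature.NumberTheory.LFunctions.ConnesVanSuijlekom
open Summit.RiemannHypothesis.RiemannHypothesis.Theorems.WeilGroundStateMarkovPart

/-! ### The theorem -/

/-- **A finite-energy odd window function at the bottom of the closed form is an odd-sector
ground state** (registered sub-goal `isWeilOddGroundState_of_energy_le` of item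
stmt-RiemannHypothesis-17778). Let `a > 0` and let `v ∈ L²` be odd, vanish off `[-a, a]`, have
`∫|v|² = 1`, integrable archimedean energy density `ρ D(v)` on `(0, ∞)`, and
`P(v) + 𝓔_a(v) ≤ M_a + ε_od(a)`. Then `IsWeilOddGroundState a v`. Proof in the module docstring
(compress by dilation, mollify, diagonal sequence, renormalise). [folklore] -/
theorem isWeilOddGroundState_of_energy_le :
    ∀ (a : ℝ) (v : ℝ → ℂ), 0 < a → MemLp v 2 → (∀ x, x ∉ Icc (-a) a → v x = 0) →
      (∀ x, v (-x) = -v x) → ∫ x, ‖v x‖ ^ 2 = (1 : ℝ) →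
      IntegrableOn (fun t ↦ weilArchDensity t * weilIncrement v t) (Ioi 0) →
      weilPoleForm v + weilDirichletEnergy a v ≤ weilMarkovConstant a + weilOddGroundEnergy a →
      IsWeilOddGroundState a v := by
  intro a v ha hv hvs hvo hvn hE hle
  set ε := weilOddGroundEnergy a with hεdef
  set M := weilMarkovConstant a with hMdef
  -- (1) the dilation step: for every `δ > 0` an `η ∈ (0, 1]` with all three errors `≤ δ`
  have hstepA : ∀ δ : ℝ, 0 < δ → ∃ η : ℝ, 0 < η ∧ η ≤ 1 ∧
      weilDirichletEnergy a (weilDilate η v) ≤ weilDirichletEnergy a v + δ ∧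
      |weilPoleForm (weilDilate η v) - weilPoleForm v| ≤ δ ∧
      ∫ x, ‖weilDilate η v x - v x‖ ^ 2 ≤ δ ∧
      IntegrableOn (fun t ↦ weilArchDensity t * weilIncrement (weilDilate η v) t) (Ioi 0) := by
    intro δ hδ
    set η : ℕ → ℝ := fun n ↦ 1 / ((n : ℝ) + 1) with hηdef
    have hη0 : ∀ n, 0 ≤ η n := fun n ↦ by positivity
    have hηpos : ∀ n, 0 < η n := fun n ↦ by positivity
    have hη1 : ∀ n, η n ≤ 1 := fun n ↦ by
      show 1 / ((n : ℝ) + 1) ≤ 1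
      rw [div_le_one (by positivity)]; linarith [n.cast_nonneg (α := ℝ)]
    have hηm1 : ∀ n, -1 < η n := fun n ↦ by linarith [hη0 n]
    have hηlim : Tendsto η atTop (𝓝 0) := tendsto_one_div_add_atTop_nhds_zero_nat
    have hEn := tendsto_weilDirichletEnergy_weilDilate a ha hv hvs hvo hE hη0 hη1 hηlim
    have hL2 := tendsto_integral_norm_sq_weilDilate_sub_of_memLp hv hvs hvo hη0 hη1 hηlim
    obtain ⟨hint, -⟩ := tendsto_archEnergy_weilDilate ha hv hvs
      (continuous_weilIncrement_of_memLp hv hvs hvo) hE hη0 hη1 hηlim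
    -- pole form along the dilates (all live on `[-a, a]`)
    have hP : Tendsto (fun n ↦ weilPoleForm (weilDilate (η n) v)) atTop (𝓝 (weilPoleForm v)) := by
      refine tendsto_weilPoleForm_of_window (R := a) hv (fun n ↦ memLp_weilDilate hv (hηm1 n)) hvs
        (fun n x hx ↦ weilDilate_eq_zero_of_notMem (hηm1 n) hvs fun hm ↦ hx ?_) hL2
      have hsub : Icc (-(a / (1 + η n))) (a / (1 + η n)) ⊆ Icc (-a) a := by
        have : a / (1 + η n) ≤ a := div_le_self ha.le (by linarith [hη0 n])
        exact Icc_subset_Icc (by linarith) this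
      exact hsub hm
    have e1 : ∀ᶠ n in atTop, weilDirichletEnergy a (weilDilate (η n) v) < weilDirichletEnergy a v + δ :=
      hEn.eventually (eventually_lt_nhds (by linarith))
    have e2 : ∀ᶠ n in atTop, |weilPoleForm (weilDilate (η n) v) - weilPoleForm v| < δ := by
      have := (Metric.tendsto_nhds.1 hP) δ hδ
      simpa only [Real.dist_eq] using this
    have e3 : ∀ᶠ n in atTop, ∫ x, ‖weilDilate (η n) v x - v x‖ ^ 2 < δ :=
      hL2.eventually (eventually_lt_nhds hδ)
    obtain ⟨n, ⟨hn1, hn2⟩, hn3⟩ := ((e1.and e2).and e3).exists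
    exact ⟨η n, hηpos n, hη1 n, hn1.le, hn2.le, hn3.le, hint n⟩
  -- (2) the mollification step
  have hstepB : ∀ (η δ : ℝ), 0 < η → η ≤ 1 → 0 < δ →
      IntegrableOn (fun t ↦ weilArchDensity t * weilIncrement (weilDilate η v) t) (Ioi 0) →
      ∃ g : ℝ → ℂ, IsWeilTest g ∧ (∀ x, g (-x) = -g x) ∧ tsupport g ⊆ Icc (-a) a ∧
        weilDirichletEnergy a g ≤ weilDirichletEnergy a (weilDilate η v) ∧
        |weilPoleForm g - weilPoleForm (weilDilate η v)| ≤ δ ∧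
        ∫ x, ‖g x - weilDilate η v x‖ ^ 2 ≤ δ := by
    intro η δ hη hη1 hδ hint
    have hηm1 : -1 < η := by linarith
    set w := weilDilate η v with hw
    set b : ℝ := a / (1 + η) with hb
    have hb0 : 0 < b := div_pos ha (by linarith)
    have hba : b < a := by rw [hb, div_lt_iff₀ (by linarith)]; nlinarith
    have hwm : MemLp w 2 := memLp_weilDilate hv hηm1
    have hws : ∀ x, x ∉ Icc (-b) b → w x = 0 := fun x hx ↦ weilDilate_eq_zero_of_notMem hηm1 hvs hx
    have hwo : ∀ x, w (-x) = -w x := fun x ↦ by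
      have h1 := stub_sectorContinuity_weilDilate_parity (g := v) (σ := -1)
        (fun t ↦ by rw [hvo t, neg_one_mul]) η x
      rwa [neg_one_mul] at h1
    obtain ⟨g, hgt, hgo, hgs, hgD, hglim⟩ := exists_odd_mollified_seq hwm hws hwo
    have hgm : ∀ k, MemLp (g k) 2 := fun k ↦ (hgt k).memLp_two
    -- all `g k` and `w` live on `[-(b+1), b+1]`
    have hk1 : ∀ k : ℕ, 1 / ((k : ℝ) + 1) ≤ 1 := fun k ↦ by
      rw [div_le_one (by positivity)]; linarith [k.cast_nonneg (α := ℝ)]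
    have hgR : ∀ k x, x ∉ Icc (-(b + 1)) (b + 1) → g k x = 0 := fun k x hx ↦
      image_eq_zero_of_notMem_tsupport fun h ↦ hx ((hgs k).trans (Icc_subset_Icc
        (by linarith [hk1 k]) (by linarith [hk1 k])) h)
    have hwR : ∀ x, x ∉ Icc (-(b + 1)) (b + 1) → w x = 0 := fun x hx ↦
      hws x fun h ↦ hx (Icc_subset_Icc (by linarith) (by linarith) h)
    have hP := tendsto_weilPoleForm_of_window hwm hgm hwR hgR hglim
    -- eventually the support fits into `[-a, a]`
    have e0 : ∀ᶠ k : ℕ in atTop, 1 / ((k : ℝ) + 1) < a - b :=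
      tendsto_one_div_add_atTop_nhds_zero_nat.eventually (eventually_lt_nhds (by linarith))
    have e2 : ∀ᶠ k in atTop, |weilPoleForm (g k) - weilPoleForm w| < δ := by
      have := (Metric.tendsto_nhds.1 hP) δ hδ
      simpa only [Real.dist_eq] using this
    have e3 : ∀ᶠ k in atTop, ∫ x, ‖g k x - w x‖ ^ 2 < δ := hglim.eventually (eventually_lt_nhds hδ)
    obtain ⟨k, ⟨hk0, hk2⟩, hk3⟩ := ((e0.and e2).and e3).exists
    refine ⟨g k, hgt k, hgo k, (hgs k).trans (Icc_subset_Icc (by linarith) (by linarith)), ?_,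
      hk2.le, hk3.le⟩
    -- energies: termwise domination of increments
    unfold weilDirichletEnergy
    refine add_le_add (Finset.sum_le_sum fun p _ ↦ mul_le_mul_of_nonneg_left (hgD k _)
      (div_nonneg ArithmeticFunction.vonMangoldt_nonneg (Real.sqrt_nonneg _))) ?_
    refine integral_mono_of_nonneg ?_ hint ?_
    · exact (ae_restrict_iff' measurableSet_Ioi).2 (Eventually.of_forall fun t ht ↦
        mul_nonneg (weilArchDensity_pos ht).le (weilIncrement_nonneg _ t))
    · exact (ae_restrict_iff' measurableSet_Ioi).2 (Eventually.of_forall fun t ht ↦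
        mul_le_mul_of_nonneg_left (hgD k t) (weilArchDensity_pos ht).le)
  -- (3) the diagonal sequence
  have hdiag : ∀ n : ℕ, ∃ g : ℝ → ℂ, (IsWeilTest g ∧ tsupport g ⊆ Icc (-a) a ∧
      (∀ x, g (-x) = -g x)) ∧
      weilPoleForm g + weilDirichletEnergy a g ≤ M + ε + 3 / ((n : ℝ) + 1) ∧
      ∫ x, ‖g x - v x‖ ^ 2 ≤ 4 / ((n : ℝ) + 1) := by
    intro n
    have hδ : (0 : ℝ) < 1 / ((n : ℝ) + 1) := by positivity
    obtain ⟨η, hη, hη1, hA1, hA2, hA3, hint⟩ := hstepA _ hδ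
    obtain ⟨g, hgt, hgo, hgs, hB1, hB2, hB3⟩ := hstepB η _ hη hη1 hδ hint
    refine ⟨g, ⟨hgt, hgs, hgo⟩, ?_, ?_⟩
    · have h1 := (abs_le.1 hA2).2
      have h2 := (abs_le.1 hB2).2
      have : (3 : ℝ) / ((n : ℝ) + 1) = 3 * (1 / ((n : ℝ) + 1)) := by ring
      rw [this]
      linarith
    · have hηm1 : -1 < η := by linarith
      have hwm : MemLp (weilDilate η v) 2 := memLp_weilDilate hv hηm1
      have h := integral_norm_sq_add_le (hgt.memLp_two.sub hwm) (hwm.sub hv)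
      have e : (fun x ↦ ‖(g - weilDilate η v) x + (weilDilate η v - v) x‖ ^ 2) =
          fun x ↦ ‖g x - v x‖ ^ 2 := by funext x; simp only [Pi.sub_apply, sub_add_sub_cancel]
      rw [e] at h
      simp only [Pi.sub_apply] at h
      have : (4 : ℝ) / ((n : ℝ) + 1) = 4 * (1 / ((n : ℝ) + 1)) := by ring
      rw [this]
      linarith
  choose g hg hgE hgL using hdiag
  have hgm : ∀ n, MemLp (g n) 2 := fun n ↦ (hg n).1.memLp_two
  -- `g n → v` in `L²`, norms `→ 1`
  have hL2 : Tendsto (fun n ↦ ∫ x, ‖g n x - v x‖ ^ 2) atTop (𝓝 0) := by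
    refine squeeze_zero (fun n ↦ integral_nonneg fun _ ↦ by positivity) hgL ?_
    have h := (tendsto_one_div_add_atTop_nhds_zero_nat (𝕜 := ℝ)).const_mul 4
    rw [mul_zero] at h
    exact h.congr fun n ↦ by ring
  have hN : Tendsto (fun n ↦ ∫ x, ‖g n x‖ ^ 2) atTop (𝓝 1) := by
    have := tendsto_integral_norm_sq hv hgm hL2
    rwa [hvn] at this
  obtain ⟨n₀, hn₀⟩ : ∃ n₀, ∀ n ≥ n₀, (1 / 2 : ℝ) ≤ ∫ x, ‖g n x‖ ^ 2 :=
    eventually_atTop.1 (hN.eventually (Ici_mem_nhds (by norm_num : (1 / 2 : ℝ) < 1)))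
  set Nn : ℕ → ℝ := fun n ↦ ∫ x, ‖g (n + n₀) x‖ ^ 2 with hNdef
  have hNpos : ∀ n, 0 < Nn n := fun n ↦
    lt_of_lt_of_le (by norm_num) (hn₀ (n + n₀) (Nat.le_add_left _ _))
  have hNlim : Tendsto Nn atTop (𝓝 1) := hN.comp (tendsto_add_atTop_nat n₀)
  -- (4) renormalise
  set c : ℕ → ℝ := fun n ↦ (Real.sqrt (Nn n))⁻¹ with hcdef
  have hcpos : ∀ n, 0 < c n := fun n ↦ inv_pos.2 (Real.sqrt_pos.2 (hNpos n))
  have hc2 : ∀ n, ‖(c n : ℂ)‖ ^ 2 = (Nn n)⁻¹ := fun n ↦ by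
    rw [Complex.norm_real, Real.norm_of_nonneg (hcpos n).le, hcdef, inv_pow,
      Real.sq_sqrt (hNpos n).le]
  have hc1 : Tendsto c atTop (𝓝 1) := by
    have h1 := (hNlim.sqrt).inv₀ (by simp)
    simpa using h1
  set f : ℕ → ℝ → ℂ := fun n x ↦ (c n : ℂ) * g (n + n₀) x with hfdef
  have hft : ∀ n, IsWeilTest (f n) := fun n ↦ (hg _).1.const_mul _
  have hfs : ∀ n, tsupport (f n) ⊆ Icc (-a) a := fun n ↦
    tsupport_mul_subset_right.trans (hg _).2.1
  have hfo : ∀ n t, f n (-t) = -f n t := fun n t ↦ by simp only [hfdef, (hg _).2.2, mul_neg]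
  have hfn : ∀ n, ∫ x, ‖f n x‖ ^ 2 = 1 := by
    intro n
    have e : (fun x ↦ ‖f n x‖ ^ 2) = fun x ↦ ‖(c n : ℂ)‖ ^ 2 * ‖g (n + n₀) x‖ ^ 2 := by
      funext x; simp only [hfdef, norm_mul, mul_pow]
    rw [e, integral_const_mul, hc2]
    exact inv_mul_cancel₀ (hNpos n).ne'
  -- `Re Q(f n) → ε`
  have hQle : ∀ n, (weilQuadratic (f n)).re ≤ (Nn n)⁻¹ * (M + ε + 3 / (((n + n₀ : ℕ) : ℝ) + 1)) - M := by
    intro n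
    rw [weilQuadratic_re_eq_weilPoleForm_add_weilDirichletEnergy_sub (hft n) (hfs n), hfn n, mul_one]
    have e1 : weilPoleForm (f n) = (Nn n)⁻¹ * weilPoleForm (g (n + n₀)) := by
      simp only [hfdef]; rw [weilPoleForm_const_mul, hc2]
    have e2 : weilDirichletEnergy a (f n) = (Nn n)⁻¹ * weilDirichletEnergy a (g (n + n₀)) := by
      simp only [hfdef]; rw [weilDirichletEnergy_const_mul, hc2]
    rw [e1, e2, ← hMdef]
    have := mul_le_mul_of_nonneg_left (hgE (n + n₀)) (inv_nonneg.2 (hNpos n).le)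
    nlinarith [this]
  have hQge : ∀ n, ε ≤ (weilQuadratic (f n)).re := fun n ↦
    weilOddGroundEnergy_le (hft n) (hfs n) (hfo n) (hfn n)
  have hup : Tendsto (fun n ↦ (Nn n)⁻¹ * (M + ε + 3 / (((n + n₀ : ℕ) : ℝ) + 1)) - M) atTop (𝓝 ε) := by
    have h1 : Tendsto (fun n ↦ (Nn n)⁻¹) atTop (𝓝 1) := by simpa using hNlim.inv₀ one_ne_zero
    have h3 : Tendsto (fun n : ℕ ↦ M + ε + 3 / (((n + n₀ : ℕ) : ℝ) + 1)) atTop (𝓝 (M + ε + 0)) := by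
      refine tendsto_const_nhds.add ?_
      have := (tendsto_one_div_add_atTop_nhds_zero_nat (𝕜 := ℝ)).comp (tendsto_add_atTop_nat n₀)
      have h4 : Tendsto (fun n : ℕ ↦ 3 * (1 / (((n + n₀ : ℕ) : ℝ) + 1))) atTop (𝓝 (3 * 0)) :=
        this.const_mul 3
      rw [mul_zero] at h4
      exact h4.congr fun n ↦ by ring
    have h4 := (h1.mul h3).sub_const M
    have e : (1 : ℝ) * (M + ε + 0) - M = ε := by ring
    rw [e] at h4
    exact h4
  have hQ : Tendsto (fun n ↦ (weilQuadratic (f n)).re) atTop (𝓝 ε) :=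
    tendsto_of_tendsto_of_tendsto_of_le_of_le tendsto_const_nhds hup hQge hQle
  -- `f n → v` in `L²`
  have hfL2 : Tendsto (fun n ↦ ∫ x, ‖f n x - v x‖ ^ 2) atTop (𝓝 0) := by
    have hb : ∀ n, ∫ x, ‖f n x - v x‖ ^ 2 ≤
        2 * ((c n - 1) ^ 2 * Nn n) + 2 * ∫ x, ‖g (n + n₀) x - v x‖ ^ 2 := by
      intro n
      have hA : MemLp (fun x ↦ (((c n - 1 : ℝ)) : ℂ) * g (n + n₀) x) 2 := (hgm _).const_mul _
      have hB : MemLp (fun x ↦ g (n + n₀) x - v x) 2 := (hgm _).sub hv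
      have h3 := integral_norm_sq_add_le hA hB
      have e3 : (fun x ↦ ‖(((c n - 1 : ℝ)) : ℂ) * g (n + n₀) x + (g (n + n₀) x - v x)‖ ^ 2) =
          fun x ↦ ‖f n x - v x‖ ^ 2 := by
        funext x; simp only [hfdef]; congr 2; push_cast; ring
      have e4 : ∫ x, ‖(((c n - 1 : ℝ)) : ℂ) * g (n + n₀) x‖ ^ 2 = (c n - 1) ^ 2 * Nn n := by
        have : (fun x ↦ ‖(((c n - 1 : ℝ)) : ℂ) * g (n + n₀) x‖ ^ 2) =
            fun x ↦ (c n - 1) ^ 2 * ‖g (n + n₀) x‖ ^ 2 := by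
          funext x; rw [norm_mul, mul_pow, Complex.norm_real, Real.norm_eq_abs, sq_abs]
        rw [this, integral_const_mul]
      rw [e3, e4] at h3
      exact h3
    refine squeeze_zero (fun n ↦ integral_nonneg fun _ ↦ by positivity) hb ?_
    have h4 : Tendsto (fun n ↦ 2 * ((c n - 1) ^ 2 * Nn n) + 2 * ∫ x, ‖g (n + n₀) x - v x‖ ^ 2)
        atTop (𝓝 (2 * ((1 - 1) ^ 2 * 1) + 2 * 0)) :=
      ((((hc1.sub_const 1).pow 2).mul hNlim).const_mul 2).add
        ((hL2.comp (tendsto_add_atTop_nat n₀)).const_mul 2)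
    simpa using h4
  exact IsWeilOddGroundState.of_tendsto hv (fun n ↦ ⟨hft n, hfs n, hfo n, hfn n⟩) hQ hfL2

end Summit.RiemannHypothesis.RiemannHypothesis.Theorems.OddSector

end
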